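import Literature.Geometry.Lorentzian.KerrDeSitterPartialModeStability
import Literature.Geometry.Lorentzian.KerrDeSitterThresholdRays
import HarnessLib

/-!
# Venture KdS — truncated mode stability of the Teukolsky equation on a Kerr–de Sitter parameter
# box: statement shapes, the reduction theorem, and the pilot box `B0`

HONEST FRAMING (venture `Summits/Ventures/KdS`, cell `pub-kds`): validated-numerics mode stability
for Kerr–de Sitter, box by box. This file states WHAT a certified box record proves and proves the
REDUCTION of that statement to (i) three cited theorems of Casals–Teixeira da Costa 2022 (named
facts of `Literature/`, one of them — Lemma 3.1 (3.7) — now a Lean theorem,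
`CasalsTeixeiraDaCosta2022_angularSign_holds`), (ii) finitely many enclosed inequalities between
horizon quantities of the box ("window constants", rung R2), and (iii) the certificates' in-window
exclusion (rung R3, DATA: interval-arithmetic records produced by two independent engines, replayed
and referee-audited — never a Lean proof). No claim about the Final State Conjecture, about
nonlinear stability, or about untruncated mode stability is made here; every statement concerns
STRICTLY GROWING modes (`Im ω > 0`), `|m| ≤ M0`, and — inside the census window — separation
constants in an explicitly printed λ-set.

Mode solutions are those of `Literature/Geometry/Lorentzian/KerrDeSitterTeukolskyRadial.lean`
(`IsModeSolution`: Casals–Teixeira da Costa 2022 Def. 3.4 with the generic boundary bullets of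
Def. 3.3; separation constant `λ` of Suzuki–Takasugi–Umetsu 1998 (3.1) = Hatsuda 2020 (2.5)).

`MSTrunc B T Λs` (for spin `s = −2`) := for every `(M, a, Λ) ∈ B`: no mode solution with
`Im ω > 0`, `|m| ≤ T.M0`, `m − s ∈ ℤ`, and — when `ω` lies in the census window `W_T(m)` — separation
constant in the certified set `Λs a Λ ω m`. Hypotheses of the reduction (`msTrunc_of_facts`):
(H1) `CasalsTeixeiraDaCosta2022_partialModeStability` (CTdC 2022 Thm 3.10, named fact),
(H2) `CasalsTeixeiraDaCosta2022_angularSign` (CTdC 2022 Lemma 3.1 (3.7); PROVED in the fact file),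
(H3) `CasalsTeixeiraDaCosta2022_partialModeStabilityProp38` (CTdC 2022 Prop. 3.8 on the
cosmological threshold ray, named fact; used through `.cosmoRay_negTwo`, `s = −2` only),
(H4) `WindowConstants B T` (enclosed inequalities between `κ_j, ϖ₂, Ω_SR` and the table's rational
corners). Statement B (in-window exclusion with `λ ∈ Λs`) is what the census certificates establish;
Statement B̄ is their verbatim wording (closed rectangles). The scalar field `s = 0`, `μ = 1`
(conformally coupled; CTdC's `μ = 1`) has its own table column (`windowScalar`, no ray exception,
no `m = 0` window). The massless scalar (`μ = 0`) is in `MasslessScalar.lean`.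

Contents: `NoModeWith` (λ-truncated `NoModeIn`), `WindowTable`, `window`/`windowBar`/regions,
`tubes`/`rect` (the two λ-set wordings), `WindowConstants`(`Scalar`), `StatementA/B/Bbar`,
`MSTrunc`(`Scalar`), the coverage theorems `statementA_of` / `statementAScalar_of` (PROVED),
`msTrunc_of_facts` (PROVED), `BranchCoverage` + `statementB_of_coverage` (W1 glue, PROVED). The
pilot box `B0`, its final window table and the venture rungs R1–R3 are in `ModeStabilityB0.lean`.
Source of the shapes: cell HOME `run/shared/lean/pub/pub-kds/` (PLAN.md A13–A24, CENSUS-SPEC.md,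
theory/B0Statement_v5.sketch.lean by the lead seat, REFEREE.md #16–#24).

References: M. Casals, R. Teixeira da Costa, Commun. Math. Phys. 394 (2022) 797–832
[CasalsTeixeiradacosta2022], Def. 3.3–3.4, Lemma 3.1, Prop. 3.8, Thm 3.10; Y. Hatsuda, Class.
Quantum Grav. 38 (2020) 025015 [Hatsuda2020], (2.5), (2.13); H. Suzuki, E. Takasugi, H. Umetsu,
Prog. Theor. Phys. 100 (1998) 491 [SuzukiTakasugiUmetsu1998], (3.1), (3.7).
-/

noncomputable section

open Set Complex

namespace Summit.Ventures.KdS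

open Literature.Geometry.Lorentzian Literature.Geometry.Lorentzian.KerrDeSitter

/-! ### Vocabulary -/

/-- `κ₂`, `κ₁`, `κ₀`: surface gravities of the cosmological, event and Cauchy horizons
(`surfaceGravity` of `KerrDeSitterThresholdRays.lean`; Casals–Teixeira da Costa 2022 (3.10)). -/
abbrev kappaCosmo (M a Λ : ℝ) : ℝ := surfaceGravity M a Λ (rCosmo M a Λ)

/-- `κ₁`: surface gravity of the event horizon (Casals–Teixeira da Costa 2022 (3.10)). -/
abbrev kappaEvent (M a Λ : ℝ) : ℝ := surfaceGravity M a Λ (rPlus M a Λ)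

/-- `κ₀`: surface gravity of the Cauchy horizon (Casals–Teixeira da Costa 2022 (3.10)). -/
abbrev kappaCauchy (M a Λ : ℝ) : ℝ := surfaceGravity M a Λ (rMinus M a Λ)

/-- Angular velocity of the cosmological horizon `ϖ₂ = a/(r₂² + a²)` (Casals–Teixeira da Costa 2022 (3.10)). -/
abbrev varpiCosmo (M a Λ : ℝ) : ℝ := horizonAngVel a (rCosmo M a Λ)

/-- No mode solution with `(ω, m) ∈ W` and separation constant in the prescribed set `Λs ω m`
(λ-truncated version of `NoModeIn`; `Λs ω m = univ` recovers it). -/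
def NoModeWith (M a Λ s : ℝ) (W : Set (ℂ × ℝ)) (Λs : ℂ → ℝ → Set ℂ) : Prop :=
  ∀ ω : ℂ, ∀ m : ℝ, (ω, m) ∈ W → (∃ k : ℤ, m - s = k) →
    ∀ lam ∈ Λs ω m, ∀ R : ℝ → ℂ, ¬IsModeSolution M a Λ s ω m lam R

/-- With the trivial λ-family `NoModeWith` is `NoModeIn`. -/
theorem noModeWith_univ_iff (M a Λ s : ℝ) (W : Set (ℂ × ℝ)) :
    NoModeWith M a Λ s W (fun _ _ => univ) ↔ NoModeIn M a Λ s W := by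
  unfold NoModeWith NoModeIn HasMode
  constructor
  · intro h ω m hW hk ⟨lam, R, hR⟩
    exact h ω m hW hk lam (mem_univ _) R hR
  · intro h ω m hW hk lam _ R hR
    exact h ω m hW hk ⟨lam, R, hR⟩

/-- A WINDOW TABLE for a parameter box (cell PLAN A14/A22): the azimuthal truncation `M0`, the
real half-widths `R m`, the common height `H` of the `s = -2` windows, and the heights `h0 m` of the
scalar (`s = 0`, `μ = 1`) windows. All entries are rationals printed in the box's records. -/
structure WindowTable where
  M0 : ℝ
  R : ℝ → ℝ
  H : ℝ
  h0 : ℝ → ℝ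

/-- The census window `W_T(m)` for `s = -2`, upper-half-plane part: `|Re ω| ≤ R_m`, `0 < Im ω ≤ H`. -/
def window (T : WindowTable) (m : ℝ) : Set ℂ := {ω | |ω.re| ≤ T.R m ∧ 0 < ω.im ∧ ω.im ≤ T.H}

/-- Region A (print): `Im ω > 0`, `|m| ≤ M0`, `ω` outside the window. -/
def regionPrint (T : WindowTable) : Set (ℂ × ℝ) :=
  {q | 0 < q.1.im ∧ |q.2| ≤ T.M0 ∧ q.1 ∉ window T q.2}

/-- Region B (certificates): `Im ω > 0`, `|m| ≤ M0`, `ω` inside the window. -/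
def regionCert (T : WindowTable) : Set (ℂ × ℝ) :=
  {q | 0 < q.1.im ∧ |q.2| ≤ T.M0 ∧ q.1 ∈ window T q.2}

/-- Cluster wording of the λ-truncation (cell PLAN A13(ii)/A14(iv), REFEREE #24 T4): tubes of
radius `X` around finitely many printed branch-centre polynomials `lamHat l ω a Λ`, `l ∈ ls`
(λ normalisation = Hatsuda 2020 (2.5) = `angularPotential`). -/
def tubes (lamHat : ℕ → ℂ → ℝ → ℝ → ℂ) (ls : Finset ℕ) (X : ℝ) (a Λ : ℝ) (ω : ℂ) (_m : ℝ) :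
    Set ℂ :=
  ⋃ l ∈ ls, {lam | ‖lam - lamHat l ω a Λ‖ < X}

/-- Rectangle wording of the λ-truncation (cell PLAN A20(v); eng-3/eng-2 records): the closed
rectangle `Λ□ = [xlo, xhi] + i[ylo, yhi]` with rational corners, constant in `(a, Λ, ω, m)`. -/
def rect (xlo xhi ylo yhi : ℝ) (_a _Λ : ℝ) (_ω : ℂ) (_m : ℝ) : Set ℂ :=
  {lam | xlo ≤ lam.re ∧ lam.re ≤ xhi ∧ ylo ≤ lam.im ∧ lam.im ≤ yhi}

/-! ### (H4) window constants of a box -/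

/-- (H4) WINDOW CONSTANTS of the box `B` for the table `T`: on every point of `B` the parameters
are subextremal with `0 < a`, `|a| < 3/Λ`, `a² < 3/Λ`; the surface gravities satisfy
`0 < κ₀, κ₁, κ₂`, `κ₁ ≤ κ₀` (side conditions of (H3)) and `κ₂ ≤ H`; and for `|m| ≤ M0`:
`|m| Ω_SR ≤ R_m`, `|m| Ω_SR ≤ H`, `|m ϖ₂| ≤ R_m`. Discharged by two engines' enclosures. -/
def WindowConstants (B : Set (ℝ × ℝ × ℝ)) (T : WindowTable) : Prop :=
  ∀ p ∈ B, IsSubextremal p.1 p.2.1 p.2.2 ∧ 0 < p.2.1 ∧ |p.2.1| < 3 / p.2.2 ∧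
    p.2.1 ^ 2 < 3 / p.2.2 ∧
    (0 < kappaCauchy p.1 p.2.1 p.2.2 ∧ 0 < kappaEvent p.1 p.2.1 p.2.2 ∧ 0 < kappaCosmo p.1 p.2.1 p.2.2 ∧
      kappaEvent p.1 p.2.1 p.2.2 ≤ kappaCauchy p.1 p.2.1 p.2.2) ∧
    kappaCosmo p.1 p.2.1 p.2.2 ≤ T.H ∧
    ∀ m : ℝ, |m| ≤ T.M0 →
      |m| * superradiantUpper p.1 p.2.1 p.2.2 ≤ T.R m ∧
      |m| * superradiantUpper p.1 p.2.1 p.2.2 ≤ T.H ∧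
      |m * horizonAngVel p.2.1 (rCosmo p.1 p.2.1 p.2.2)| ≤ T.R m

/-! ### Statements A, B and MS_trunc, for `s = -2` -/

/-- STATEMENT A (from the cited facts alone): off the window there is no mode at all, `|m| ≤ M0`. -/
def StatementA (B : Set (ℝ × ℝ × ℝ)) (T : WindowTable) : Prop :=
  ∀ p ∈ B, NoModeIn p.1 p.2.1 p.2.2 (-2) (regionPrint T)

/-- STATEMENT B (what the census certificates establish): inside the window, no mode whose
separation constant lies in the certified λ-set family `Λs a Λ ω m`. -/
def StatementB (B : Set (ℝ × ℝ × ℝ)) (T : WindowTable) (Λs : ℝ → ℝ → ℂ → ℝ → Set ℂ) : Prop :=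
  ∀ p ∈ B, NoModeWith p.1 p.2.1 p.2.2 (-2) (regionCert T) (Λs p.2.1 p.2.2)

/-- The CLOSED certified rectangle `W̄(m) = [−R_m, R_m] × [−η, H]` — what a signed record states
verbatim (the real segment and the strip `−η ≤ Im ω ≤ 0` included, cell PLAN §1.5);
`window T m ⊆ windowBar T η m`. -/
def windowBar (T : WindowTable) (η : ℝ) (m : ℝ) : Set ℂ :=
  {ω | |ω.re| ≤ T.R m ∧ -η ≤ ω.im ∧ ω.im ≤ T.H}

/-- The open-in-`Im` census window lies in the closed record rectangle. -/
theorem window_subset_windowBar (T : WindowTable) {η : ℝ} (hη : 0 ≤ η) (m : ℝ) :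
    window T m ⊆ windowBar T η m := fun _ ⟨h1, h2, h3⟩ => ⟨h1, by linarith, h3⟩

/-- Record region (s = -2): `|m| ≤ M0`, `ω ∈ W̄(m)`. -/
def regionCertBar (T : WindowTable) (η : ℝ) : Set (ℂ × ℝ) :=
  {q | |q.2| ≤ T.M0 ∧ q.1 ∈ windowBar T η q.2}

/-- Statement B̄ (record wording, s = -2): no mode with `|m| ≤ M0`, `ω ∈ W̄(m)`, `λ ∈ Λs` — for ALL
`Im ω ≥ −η`, not only `Im ω > 0`. -/
def StatementBbar (B : Set (ℝ × ℝ × ℝ)) (T : WindowTable) (η : ℝ)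
    (Λs : ℝ → ℝ → ℂ → ℝ → Set ℂ) : Prop :=
  ∀ p ∈ B, NoModeWith p.1 p.2.1 p.2.2 (-2) (regionCertBar T η) (Λs p.2.1 p.2.2)

/-- The record wording implies Statement B. -/
theorem statementB_of_bar {B : Set (ℝ × ℝ × ℝ)} {T : WindowTable} {η : ℝ}
    {Λs : ℝ → ℝ → ℂ → ℝ → Set ℂ} (hη : 0 ≤ η) (h : StatementBbar B T η Λs) :
    StatementB B T Λs :=
  fun p hp ω m hq hk lam hlam R =>
    h p hp ω m ⟨hq.2.1, window_subset_windowBar T hη m hq.2.2⟩ hk lam hlam R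

/-- MS_trunc(B; s = -2, M0, Λs): STRICTLY GROWING MODES ONLY (`Im ω > 0`). -/
def MSTrunc (B : Set (ℝ × ℝ × ℝ)) (T : WindowTable) (Λs : ℝ → ℝ → ℂ → ℝ → Set ℂ) : Prop :=
  ∀ p ∈ B, NoModeWith p.1 p.2.1 p.2.2 (-2) {q | 0 < q.1.im ∧ |q.2| ≤ T.M0}
    (fun ω m => {lam | ω ∈ window T m → lam ∈ Λs p.2.1 p.2.2 ω m})

/-- Statement A (off-window, from print) and Statement B (in-window, certificates) give MS_trunc. -/
theorem msTrunc_of {B : Set (ℝ × ℝ × ℝ)} {T : WindowTable} {Λs : ℝ → ℝ → ℂ → ℝ → Set ℂ}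
    (hA : StatementA B T) (hB : StatementB B T Λs) : MSTrunc B T Λs := by
  intro p hp ω m hq hk lam hlam R hR
  obtain ⟨him, hm⟩ := hq
  by_cases hw : ω ∈ window T m
  · exact hB p hp ω m ⟨him, hm, hw⟩ hk lam (hlam hw) R hR
  · exact hA p hp ω m ⟨him, hm, hw⟩ hk ⟨lam, R, hR⟩

/-- COVERAGE (cell REFEREE #21(3)), any box and table: for `(M, a, Λ) ∈ B`, `|m| ≤ M0`, `Im ω > 0`
and `ω` outside the window, either `ω` is off the cosmological threshold ray with `|ω| ≥ |m| Ω_SR`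
((H1)+(H2) exclude a mode: Casals–Teixeira da Costa 2022 Thm 3.10 + Lemma 3.1), or `ω` is on the ray
above `H ≥ κ₂` with `|ω| ≥ |m| Ω_SR` ((H3), their Prop. 3.8, excludes it). -/
theorem statementA_of {B : Set (ℝ × ℝ × ℝ)} {T : WindowTable}
    (h1 : CasalsTeixeiraDaCosta2022_partialModeStability) (h2 : CasalsTeixeiraDaCosta2022_angularSign)
    (h3 : CasalsTeixeiraDaCosta2022_partialModeStabilityProp38) (h4 : WindowConstants B T) :
    StatementA B T := by
  intro p hp ω m hq hk hmode
  obtain ⟨hIm, hm2, hnotW⟩ := hq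
  obtain ⟨lam, R, hang, hrad, hin, hout, hnt⟩ := hmode
  obtain ⟨hsub, hapos, haL, haL2, ⟨hk0, hk1, hk2pos, hk10⟩, hkap, hconst⟩ := h4 p hp
  obtain ⟨hΩ, hΩH, hϖ⟩ := hconst m hm2
  have ha : 0 ≤ p.2.1 := hapos.le
  have hs : ∃ k : ℤ, 2 * (-2 : ℝ) = k := ⟨-4, by norm_num⟩
  have hlam := (h2 _ _ _ _ _ _ hsub.2.1 hapos hs hk hIm hang).le
  have hnotW' : |ω.re| ≤ T.R m → T.H < ω.im := by
    intro hre
    by_contra hle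
    exact hnotW ⟨hre, hIm, not_lt.mp hle⟩
  have hbig : |m| * superradiantUpper p.1 p.2.1 p.2.2 ≤ ‖ω‖ := by
    by_cases hre : |ω.re| ≤ T.R m
    · calc |m| * superradiantUpper p.1 p.2.1 p.2.2 ≤ T.H := hΩH
        _ ≤ ω.im := le_of_lt (hnotW' hre)
        _ ≤ |ω.im| := le_abs_self _
        _ ≤ ‖ω‖ := Complex.abs_im_le_norm ω
    · calc |m| * superradiantUpper p.1 p.2.1 p.2.2 ≤ T.R m := hΩ
        _ ≤ |ω.re| := le_of_lt (not_le.mp hre)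
        _ ≤ ‖ω‖ := Complex.abs_re_le_norm ω
  by_cases hray : ω.re = m * horizonAngVel p.2.1 (rCosmo p.1 p.2.1 p.2.2)
  · have hre : |ω.re| ≤ T.R m := by rw [hray]; exact hϖ
    have hk2 : kappaCosmo p.1 p.2.1 p.2.2 < ω.im := lt_of_le_of_lt hkap (hnotW' hre)
    have hm' : ∃ k : ℤ, m + 2 = k := by
      obtain ⟨k, hk'⟩ := hk
      exact ⟨k, by linarith⟩
    have hw := CasalsTeixeiraDaCosta2022_partialModeStabilityProp38.cosmoRay_negTwo h3 hsub ha haL hm'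
      hk0 hk1 hk2pos hk10 hray hk2 hlam hrad hin hout hnt
    exact absurd hw.2 (not_lt.mpr hbig)
  · have hw := CasalsTeixeiraDaCosta2022_partialModeStability.window h1 hsub ha haL haL2 hs hk hIm hlam
      (Or.inr (by norm_num)) (Or.inl hray) hrad hin hout hnt
    exact absurd hw.2 (not_lt.mpr hbig)

/-- The theorem shape for `s = -2`, any box: MS_trunc from the three literature hypotheses, the
window constants and the certificates' Statement B. -/
theorem msTrunc_of_facts {B : Set (ℝ × ℝ × ℝ)} {T : WindowTable} {Λs : ℝ → ℝ → ℂ → ℝ → Set ℂ}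
    (h1 : CasalsTeixeiraDaCosta2022_partialModeStability) (h2 : CasalsTeixeiraDaCosta2022_angularSign)
    (h3 : CasalsTeixeiraDaCosta2022_partialModeStabilityProp38) (h4 : WindowConstants B T)
    (hB : StatementB B T Λs) : MSTrunc B T Λs :=
  msTrunc_of (statementA_of h1 h2 h3 h4) hB

/-- The theorem shape for `s = -2` with (H2) DISCHARGED (`CasalsTeixeiraDaCosta2022_angularSign_holds`,
Casals–Teixeira da Costa 2022 Lemma 3.1 (3.7) proved in `KerrDeSitterPartialModeStability.lean`):
MS_trunc from (H1), (H3), the window constants and Statement B. -/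
theorem msTrunc_of_facts' {B : Set (ℝ × ℝ × ℝ)} {T : WindowTable} {Λs : ℝ → ℝ → ℂ → ℝ → Set ℂ}
    (h1 : CasalsTeixeiraDaCosta2022_partialModeStability)
    (h3 : CasalsTeixeiraDaCosta2022_partialModeStabilityProp38) (h4 : WindowConstants B T)
    (hB : StatementB B T Λs) : MSTrunc B T Λs :=
  msTrunc_of_facts h1 CasalsTeixeiraDaCosta2022_angularSign_holds h3 h4 hB

/-! ### The scalar field `s = 0`, `μ = 1` (CENSUS-SPEC runs 7/8): no ray exception, no `m = 0` window -/

/-- The census window for `s = 0`, `μ = 1`: `|Re ω| ≤ R_m`, `0 < Im ω ≤ h0 m`; empty for `m = 0`. -/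
def windowScalar (T : WindowTable) (m : ℝ) : Set ℂ :=
  {ω | m ≠ 0 ∧ |ω.re| ≤ T.R m ∧ 0 < ω.im ∧ ω.im ≤ T.h0 m}

/-- Region A, scalar column: `Im ω > 0`, `|m| ≤ M0`, `ω` outside the scalar window. -/
def regionPrintScalar (T : WindowTable) : Set (ℂ × ℝ) :=
  {q | 0 < q.1.im ∧ |q.2| ≤ T.M0 ∧ q.1 ∉ windowScalar T q.2}

/-- Region B, scalar column: `Im ω > 0`, `|m| ≤ M0`, `ω` inside the scalar window. -/
def regionCertScalar (T : WindowTable) : Set (ℂ × ℝ) :=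
  {q | 0 < q.1.im ∧ |q.2| ≤ T.M0 ∧ q.1 ∈ windowScalar T q.2}

/-- (H4s) the extra enclosed inequality of the scalar table: `|m| Ω_SR ≤ h0 m` for `0 < |m| ≤ M0`. -/
def WindowConstantsScalar (B : Set (ℝ × ℝ × ℝ)) (T : WindowTable) : Prop :=
  ∀ p ∈ B, ∀ m : ℝ, |m| ≤ T.M0 → m ≠ 0 → |m| * superradiantUpper p.1 p.2.1 p.2.2 ≤ T.h0 m

/-- STATEMENT A, scalar column (`s = 0`, `μ = 1`): off the scalar window, no mode at all. -/
def StatementAScalar (B : Set (ℝ × ℝ × ℝ)) (T : WindowTable) : Prop :=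
  ∀ p ∈ B, NoModeIn p.1 p.2.1 p.2.2 0 (regionPrintScalar T)

/-- STATEMENT B, scalar column: inside the scalar window, no mode with `λ ∈ Λs`. -/
def StatementBScalar (B : Set (ℝ × ℝ × ℝ)) (T : WindowTable) (Λs : ℝ → ℝ → ℂ → ℝ → Set ℂ) :
    Prop :=
  ∀ p ∈ B, NoModeWith p.1 p.2.1 p.2.2 0 (regionCertScalar T) (Λs p.2.1 p.2.2)

/-- Closed scalar rectangle `[−R_m, R_m] × [−η, h0 m]`, `m ≠ 0`. -/
def windowBarScalar (T : WindowTable) (η : ℝ) (m : ℝ) : Set ℂ :=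
  {ω | m ≠ 0 ∧ |ω.re| ≤ T.R m ∧ -η ≤ ω.im ∧ ω.im ≤ T.h0 m}

/-- The scalar census window lies in the closed scalar record rectangle. -/
theorem windowScalar_subset_windowBarScalar (T : WindowTable) {η : ℝ} (hη : 0 ≤ η) (m : ℝ) :
    windowScalar T m ⊆ windowBarScalar T η m :=
  fun _ ⟨h0, h1, h2, h3⟩ => ⟨h0, h1, by linarith, h3⟩

/-- Record region, scalar column: `|m| ≤ M0`, `ω ∈ W̄₀(m)`. -/
def regionCertBarScalar (T : WindowTable) (η : ℝ) : Set (ℂ × ℝ) :=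
  {q | |q.2| ≤ T.M0 ∧ q.1 ∈ windowBarScalar T η q.2}

/-- Statement B̄ (record wording, s = 0, μ = 1). -/
def StatementBbarScalar (B : Set (ℝ × ℝ × ℝ)) (T : WindowTable) (η : ℝ)
    (Λs : ℝ → ℝ → ℂ → ℝ → Set ℂ) : Prop :=
  ∀ p ∈ B, NoModeWith p.1 p.2.1 p.2.2 0 (regionCertBarScalar T η) (Λs p.2.1 p.2.2)

/-- The scalar record wording implies the scalar Statement B. -/
theorem statementBScalar_of_bar {B : Set (ℝ × ℝ × ℝ)} {T : WindowTable} {η : ℝ}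
    {Λs : ℝ → ℝ → ℂ → ℝ → Set ℂ} (hη : 0 ≤ η) (h : StatementBbarScalar B T η Λs) :
    StatementBScalar B T Λs :=
  fun p hp ω m hq hk lam hlam R =>
    h p hp ω m ⟨hq.2.1, windowScalar_subset_windowBarScalar T hη m hq.2.2⟩ hk lam hlam R

/-- MS_trunc, scalar column (`s = 0`, `μ = 1`), strictly growing modes only. -/
def MSTruncScalar (B : Set (ℝ × ℝ × ℝ)) (T : WindowTable) (Λs : ℝ → ℝ → ℂ → ℝ → Set ℂ) : Prop :=
  ∀ p ∈ B, NoModeWith p.1 p.2.1 p.2.2 0 {q | 0 < q.1.im ∧ |q.2| ≤ T.M0}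
    (fun ω m => {lam | ω ∈ windowScalar T m → lam ∈ Λs p.2.1 p.2.2 ω m})

/-- Scalar column: Statement A and Statement B give MS_trunc. -/
theorem msTruncScalar_of {B : Set (ℝ × ℝ × ℝ)} {T : WindowTable} {Λs : ℝ → ℝ → ℂ → ℝ → Set ℂ}
    (hA : StatementAScalar B T) (hB : StatementBScalar B T Λs) : MSTruncScalar B T Λs := by
  intro p hp ω m hq hk lam hlam R hR
  obtain ⟨him, hm⟩ := hq
  by_cases hw : ω ∈ windowScalar T m
  · exact hB p hp ω m ⟨him, hm, hw⟩ hk lam (hlam hw) R hR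
  · exact hA p hp ω m ⟨him, hm, hw⟩ hk ⟨lam, R, hR⟩

/-- COVERAGE, scalar table: Statement A from (H1), (H2), (H4), (H4s) — no (H3). -/
theorem statementAScalar_of {B : Set (ℝ × ℝ × ℝ)} {T : WindowTable}
    (h1 : CasalsTeixeiraDaCosta2022_partialModeStability) (h2 : CasalsTeixeiraDaCosta2022_angularSign)
    (h4 : WindowConstants B T) (h4s : WindowConstantsScalar B T) : StatementAScalar B T := by
  intro p hp ω m hq hk hmode
  obtain ⟨hIm, hm2, hnotW⟩ := hq
  obtain ⟨lam, R, hang, hrad, hin, hout, hnt⟩ := hmode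
  obtain ⟨hsub, hapos, haL, haL2, _hks, _hkap, hconst⟩ := h4 p hp
  obtain ⟨hΩ, _hΩH, _hϖ⟩ := hconst m hm2
  have ha : 0 ≤ p.2.1 := hapos.le
  have hs : ∃ k : ℤ, 2 * (0 : ℝ) = k := ⟨0, by norm_num⟩
  have hlam := (h2 _ _ _ _ _ _ hsub.2.1 hapos hs hk hIm hang).le
  have hw := CasalsTeixeiraDaCosta2022_partialModeStability.window h1 hsub ha haL haL2 hs hk hIm hlam
    (Or.inr le_rfl) (Or.inr le_rfl) hrad hin hout hnt
  by_cases hm0 : m = 0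
  · have h0 : ‖ω‖ < 0 := by simpa [hm0] using hw.2
    exact (not_lt.mpr (norm_nonneg ω)) h0
  · have hh := h4s p hp m hm2 hm0
    have hnotW' : |ω.re| ≤ T.R m → T.h0 m < ω.im := by
      intro hre
      by_contra hle
      exact hnotW ⟨hm0, hre, hIm, not_lt.mp hle⟩
    have hbig : |m| * superradiantUpper p.1 p.2.1 p.2.2 ≤ ‖ω‖ := by
      by_cases hre : |ω.re| ≤ T.R m
      · calc |m| * superradiantUpper p.1 p.2.1 p.2.2 ≤ T.h0 m := hh
          _ ≤ ω.im := le_of_lt (hnotW' hre)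
          _ ≤ |ω.im| := le_abs_self _
          _ ≤ ‖ω‖ := Complex.abs_im_le_norm ω
      · calc |m| * superradiantUpper p.1 p.2.1 p.2.2 ≤ T.R m := hΩ
          _ ≤ |ω.re| := le_of_lt (not_le.mp hre)
          _ ≤ ‖ω‖ := Complex.abs_re_le_norm ω
    exact absurd hw.2 (not_lt.mpr hbig)

/-- The theorem shape for the scalar column: MS_trunc from (H1), (H2), (H4), (H4s) and the
certificates' Statement B. -/
theorem msTruncScalar_of_facts {B : Set (ℝ × ℝ × ℝ)} {T : WindowTable}
    {Λs : ℝ → ℝ → ℂ → ℝ → Set ℂ}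
    (h1 : CasalsTeixeiraDaCosta2022_partialModeStability) (h2 : CasalsTeixeiraDaCosta2022_angularSign)
    (h4 : WindowConstants B T) (h4s : WindowConstantsScalar B T) (hB : StatementBScalar B T Λs) :
    MSTruncScalar B T Λs :=
  msTruncScalar_of (statementAScalar_of h1 h2 h4 h4s) hB

/-- Scalar column with (H2) DISCHARGED: MS_trunc from (H1), (H4), (H4s) and Statement B. -/
theorem msTruncScalar_of_facts' {B : Set (ℝ × ℝ × ℝ)} {T : WindowTable}
    {Λs : ℝ → ℝ → ℂ → ℝ → Set ℂ} (h1 : CasalsTeixeiraDaCosta2022_partialModeStability)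
    (h4 : WindowConstants B T) (h4s : WindowConstantsScalar B T) (hB : StatementBScalar B T Λs) :
    MSTruncScalar B T Λs :=
  msTruncScalar_of_facts h1 CasalsTeixeiraDaCosta2022_angularSign_holds h4 h4s hB

/-! ### (W1) Branch coverage: upgrading the λ-set of Statement B (total-count certificates) -/

/-- (W1) BRANCH COVERAGE on `B` for spin `s`: inside the census region, every angular eigenvalue in
the LARGE λ-set `Big` already lies in the SMALL certified λ-set `Λs`. Data, like Statement B. -/
def BranchCoverage (B : Set (ℝ × ℝ × ℝ)) (s : ℝ) (region : Set (ℂ × ℝ))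
    (Big Λs : ℝ → ℝ → ℂ → ℝ → Set ℂ) : Prop :=
  ∀ p ∈ B, ∀ (ω : ℂ) (m : ℝ) (lam : ℂ), (ω, m) ∈ region → lam ∈ Big p.2.1 p.2.2 ω m →
    IsAngularEigenvalue p.2.1 p.2.2 s ω m lam → lam ∈ Λs p.2.1 p.2.2 ω m

/-- (W1) glue: a branch-coverage certificate upgrades Statement B from the small λ-set to the large one. -/
theorem statementB_of_coverage {B : Set (ℝ × ℝ × ℝ)} {T : WindowTable}
    {Big Λs : ℝ → ℝ → ℂ → ℝ → Set ℂ}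
    (hcov : BranchCoverage B (-2) (regionCert T) Big Λs) (hB : StatementB B T Λs) :
    StatementB B T Big := by
  intro p hp ω m hq hk lam hlam R hmode
  exact hB p hp ω m hq hk lam (hcov p hp ω m lam hq hlam hmode.1) R hmode

/-- (W1) glue, scalar column. -/
theorem statementBScalar_of_coverage {B : Set (ℝ × ℝ × ℝ)} {T : WindowTable}
    {Big Λs : ℝ → ℝ → ℂ → ℝ → Set ℂ}
    (hcov : BranchCoverage B 0 (regionCertScalar T) Big Λs) (hB : StatementBScalar B T Λs) :
    StatementBScalar B T Big := by
  intro p hp ω m hq hk lam hlam R hmode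
  exact hB p hp ω m hq hk lam (hcov p hp ω m lam hq hlam hmode.1) R hmode

end Summit.Ventures.KdS

end
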